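import Literature.NumberTheory.LFunctions.DirichletExplicitRegionMidHeightPole
import Literature.NumberTheory.LFunctions.ZetaFirstZeroCertificate
import Literature.NumberTheory.LFunctions.GeneralizedRH
import HarnessLib

/-!
# McCurley's Theorem 1 for zeros of height `|t| ≤ 1`, arbitrary characters — PROVED

Topic `Literature/NumberTheory/LFunctions`, completing the `|t| ≤ 1` part of the named fact
`McCurley1984_theorem1_closed = AtMostOneZeroInClosedRegion 9.645908801 10` (`ZeroFreeRegionUpTo.lean`):
the clauses for primitive characters (`McCurleyStechkin.height_le_one`, files
`DirichletExplicitRegion{RealZeros,SmallHeight,MidHeight,MidHeightPole}.lean`) are transported to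
arbitrary characters mod `q` through the primitive character inducing `χ` (`L(s,χ) = 0 ↔ L(s,χ⋆) = 0`
for `Re s > 0`, `s ≠ 1`, the tree's `LFunction_eq_zero_iff_primitiveCharacter`; conductor `≤ q`), and
the principal character is `ζ(s)∏_{p∣q}(1 − p^{−s})`, zero-free for `0 < |Im s| ≤ 14` by the tree's
kernel-certified `N(14) = 0` (`riemannZeta_ne_zero_of_im_pos_of_im_le_fourteen`; McCurley quotes
Rosser–Schoenfeld's region for `ζ`, his Lemma 8). Everything here is PROVED; no definitions, no facts.

## Main results

* `McCurleyStechkin.re_lt_of_height_le_one`: for any `χ` mod `q ≥ 1` and any zero `s` of `L(s,χ)`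
  with `0 < |Im s| ≤ 1`: `Re s < 1 − 1/(R log max(q,10))`, `R = 9.645908801`.
* `mccurley1984_theorem1_closed_of_abs_im_le_one`: `AtMostOneZeroInClosedRegion 9.645908801 10`
  (McCurley's Theorem 1 as printed, closed region, `M = max(q, q|t|, 10)`) **for pairs of zeros with
  `|Im sᵢ| ≤ 1`**: both are real, equal, and come from one real non-principal character.
What remains of `McCurley1984_theorem1_closed` is exactly the case `|Im s| > 1` (McCurley §4).

## References

* K. S. McCurley, *Explicit zero-free regions for Dirichlet L-functions*, J. Number Theory 19 (1984)
  7–32, Theorem 1 (p. 8), §5–§6. [McCurley1984ZFR]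
* H. Davenport, *Multiplicative Number Theory*, ch. 5 (2)–(3) (induced characters). [DavenportMNT1980]
-/

noncomputable section

open Real Complex

namespace Literature.NumberTheory.LFunctions

namespace McCurleyStechkin

open DirichletCharacter

/-- `1.609437 ≤ log 5`. [folklore] -/
private theorem log_five_ge_aux : (1.609437 : ℝ) ≤ Real.log 5 := by
  rw [Real.le_log_iff_exp_le (by norm_num)]
  have h1 : Real.exp 1.609437 = Real.exp 1 * Real.exp 0.609437 := by rw [← Real.exp_add]; norm_num
  have h2 : Real.exp 0.609437 ≤ 1.839396 := by
    have h := Real.exp_bound' (x := (0.609437 : ℝ)) (by norm_num) (by norm_num) (n := 7) (by norm_num)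
    refine h.trans ?_
    simp only [Finset.sum_range_succ, Finset.sum_range_zero, Nat.factorial]
    norm_num
  rw [h1]
  have := Real.exp_one_lt_d9
  nlinarith [Real.exp_pos 0.609437]

/-- `log 10 ≥ 2.30258`. [folklore] -/
private theorem log_ten_ge_aux : (2.30258 : ℝ) ≤ Real.log 10 := by
  have h : Real.log 10 = Real.log 2 + Real.log 5 := by
    rw [show (10 : ℝ) = 2 * 5 by norm_num, Real.log_mul (by norm_num) (by norm_num)]
  rw [h]
  have h2 := Real.log_two_gt_d9
  have h5 := log_five_ge_aux
  linarith

/-- The principal `L`-function mod `q` has no zeros with `Re s > 0`, `0 < |Im s| ≤ 14`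
(`L(s,χ₀) = ζ(s)∏_{p∣q}(1 − p^{−s})` and `N(14) = 0`). [cite: McCurley1984ZFR, Lemma 8 (via Rosser–Schoenfeld); Edwards1974, §6.6] -/
theorem LFunction_one_ne_zero_of_abs_im_le {q : ℕ} [NeZero q] {s : ℂ} (hre : 0 < s.re)
    (him0 : s.im ≠ 0) (him : |s.im| ≤ 14) : (1 : DirichletCharacter ℂ q).LFunction s ≠ 0 := by
  have hs1 : s ≠ 1 := fun h ↦ him0 (by rw [h]; simp)
  have hζ : riemannZeta s ≠ 0 := by
    rcases lt_or_gt_of_ne him0 with h | h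
    · have h' : 0 < (starRingEnd ℂ s).im := by simp [h]
      have h14 : (starRingEnd ℂ s).im ≤ 14 := by
        simp only [Complex.conj_im]; linarith [(abs_le.1 him).1]
      have hne := riemannZeta_ne_zero_of_im_pos_of_im_le_fourteen h' h14
      rw [riemannZeta_conj] at hne
      exact fun h0 ↦ hne (by rw [h0, map_zero])
    · exact riemannZeta_ne_zero_of_im_pos_of_im_le_fourteen h (abs_le.1 him).2
  rw [← DirichletCharacter.changeLevel_one (one_dvd q),
    DirichletCharacter.LFunction_changeLevel (one_dvd q) (1 : DirichletCharacter ℂ 1) (Or.inr hs1),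
    DirichletCharacter.LFunction_modOne_eq]
  refine mul_ne_zero hζ (Finset.prod_ne_zero_iff.2 fun p hp ↦ ?_)
  have hpP := Nat.prime_of_mem_primeFactors hp
  rw [MulChar.one_apply (isUnit_of_subsingleton _), one_mul, sub_ne_zero]
  intro h
  have hn : ‖(p : ℂ) ^ (-s)‖ < 1 := by
    rw [Complex.norm_natCast_cpow_of_pos hpP.pos, Complex.neg_re]
    exact Real.rpow_lt_one_of_one_lt_of_neg (by exact_mod_cast hpP.one_lt) (by linarith)
  rw [← h, norm_one] at hn
  exact lt_irrefl _ hn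

/-- **McCurley's Theorem 1 for complex zeros of height `≤ 1`, arbitrary characters.** For any
Dirichlet character `χ` mod `q ≥ 1` and any zero `s` of `L(s, χ)` with `0 < |Im s| ≤ 1`:
`Re s < 1 − 1/(R log max(q, 10))`, `R = 9.645908801` (for `|t| ≤ 1`, `max(q, q|t|, 10) = max(q,10)`).
[cite: McCurley1984ZFR, Theorem 1 (p. 8)] -/
theorem re_lt_of_height_le_one {q : ℕ} [NeZero q] (χ : DirichletCharacter ℂ q) {s : ℂ}
    (hz : χ.LFunction s = 0) (him0 : s.im ≠ 0) (him : |s.im| ≤ 1) :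
    s.re < 1 - 1 / (9.645908801 * Real.log (max (q : ℝ) 10)) := by
  set L : ℝ := Real.log (max (q : ℝ) 10) with hLdef
  have hq1 : (1 : ℝ) ≤ q := by exact_mod_cast Nat.one_le_iff_ne_zero.2 (NeZero.ne q)
  have hL10 : Real.log 10 ≤ L := Real.log_le_log (by norm_num) (le_max_right _ _)
  have hLq : Real.log q ≤ L := Real.log_le_log (by linarith) (le_max_left _ _)
  have hL : 2.30258 ≤ L := log_ten_ge_aux.trans hL10
  have hLpos : 0 < L := by linarith
  by_contra hcon
  have hw := not_lt.1 hcon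
  have hwin : 1 / (9.645908801 * L) ≤ 0.0451 := by
    rw [div_le_iff₀ (by positivity)]; nlinarith
  have hre : 0 < s.re := by linarith
  have hs1 : s ≠ 1 := fun h ↦ him0 (by rw [h]; simp)
  by_cases h1 : χ = 1
  · subst h1
    exact LFunction_one_ne_zero_of_abs_im_le hre him0 (him.trans (by norm_num)) hz
  -- reduce to the primitive character inducing `χ`
  haveI : NeZero χ.conductor := ⟨χ.conductor_ne_zero⟩
  have hzψ : χ.primitiveCharacter.LFunction s = 0 :=
    (DirichletCharacter.LFunction_eq_zero_iff_primitiveCharacter χ hre hs1).1 hz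
  have hψ : χ.primitiveCharacter.IsPrimitive := DirichletCharacter.primitiveCharacter_isPrimitive χ
  have hψ1 : χ.primitiveCharacter ≠ 1 := by
    intro h
    apply h1
    rw [← DirichletCharacter.changeLevel_primitiveCharacter χ, h, DirichletCharacter.changeLevel_one]
  have hcond : (χ.conductor : ℝ) ≤ q := by
    exact_mod_cast Nat.le_of_dvd (Nat.pos_of_ne_zero (NeZero.ne q)) χ.conductor_dvd_level
  have hcond1 : (1 : ℝ) ≤ χ.conductor := by
    exact_mod_cast Nat.one_le_iff_ne_zero.2 χ.conductor_ne_zero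
  have hLk : Real.log (χ.conductor : ℝ) ≤ L := (Real.log_le_log (by linarith) hcond).trans hLq
  have h := height_le_one hψ hψ1 hLk hL10 hzψ him (fun _ ↦ him0)
  exact hcon h

end McCurleyStechkin

/-- **McCurley's Theorem 1 (closed region) for zeros of height `|Im s| ≤ 1`**: the statement
`AtMostOneZeroInClosedRegion 9.645908801 10` — "`∏_χ L(s, χ)` has at most a single zero in
`σ ≥ 1 − 1/(R log M)`, `M = max(q, q|t|, 10)`, and it is a real zero of a real non-principal
character" — restricted to pairs of zeros with `|Im sᵢ| ≤ 1`. (Complex zeros of height `≤ 1`: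
`McCurleyStechkin.re_lt_of_height_le_one`; real zeros: `mccurley1984_theorem1_closed_of_im_eq_zero`.)
[cite: McCurley1984ZFR, Theorem 1 (p. 8)] -/
theorem mccurley1984_theorem1_closed_of_abs_im_le_one :
    ∀ (q : ℕ) [NeZero q], 3 ≤ q →
      ∀ (χ₁ χ₂ : DirichletCharacter ℂ q) (s₁ s₂ : ℂ), |s₁.im| ≤ 1 → |s₂.im| ≤ 1 → s₁ ≠ 1 → s₂ ≠ 1 →
        1 - 1 / (9.645908801 * Real.log (max (max (q : ℝ) ((q : ℝ) * |s₁.im|)) 10)) ≤ s₁.re →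
        1 - 1 / (9.645908801 * Real.log (max (max (q : ℝ) ((q : ℝ) * |s₂.im|)) 10)) ≤ s₂.re →
        χ₁.LFunction s₁ = 0 → χ₂.LFunction s₂ = 0 →
        (χ₁ = χ₂ ∧ s₁ = s₂) ∧ s₁.im = 0 ∧ χ₁ ≠ 1 ∧ χ₁ ^ 2 = 1 := by
  intro q _ hq χ₁ χ₂ s₁ s₂ hi₁ hi₂ hs₁ hs₂ hr₁ hr₂ hz₁ hz₂
  have hq0 : (0 : ℝ) ≤ q := by positivity
  -- for `|t| ≤ 1`: `max(q, q|t|) = q`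
  have hm : ∀ s : ℂ, |s.im| ≤ 1 → max (q : ℝ) ((q : ℝ) * |s.im|) = q := fun s hs ↦
    max_eq_left (by nlinarith [abs_nonneg s.im])
  have him₁ : s₁.im = 0 := by
    by_contra h
    have := McCurleyStechkin.re_lt_of_height_le_one χ₁ hz₁ h hi₁
    rw [hm s₁ hi₁] at hr₁
    linarith
  have him₂ : s₂.im = 0 := by
    by_contra h
    have := McCurleyStechkin.re_lt_of_height_le_one χ₂ hz₂ h hi₂
    rw [hm s₂ hi₂] at hr₂
    linarith
  exact mccurley1984_theorem1_closed_of_im_eq_zero q hq χ₁ χ₂ s₁ s₂ him₁ him₂ hs₁ hs₂ hr₁ hr₂ hz₁ hz₂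

end Literature.NumberTheory.LFunctions
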